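import Literature.NumberTheory.Automorphic.MeyerRatLogCoordinate
import Literature.NumberTheory.Automorphic.MeyerPiPlusTwoDimensional
import HarnessLib

/-!
# Meyer's global difference representation — proofs, `K = ℚ`: the theta vectors lie in `H₊ ∩ H₋`

Topic `NumberTheory/Automorphic`; namespace `Literature.NumberTheory.Automorphic.Meyer`. Sibling
PROOF file of `MeyerDifferenceRepresentation` (Step B/D of the plan for
`Meyer.spectralRealisation_rat` [Meyer2005, Thm. 5.11]). Combining

* `iMinus_meyerSum_ratTensor_mem_Hplus` (`MeyerRatTheta`): for `G ∈ 𝓢(ℝ)` with `G(0) = 0 = ∫ G`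
  and the self-dual `μ`, `(Σ(G ⊗ 1_Ẑ), Σ(G ⊗ 1_Ẑ)) ∈ H₊`;
* `mem_HminusIm_of_fst_sub_snd_eq_zero` (`MeyerPiPlusTwoDimensional`, Meyer's Lemma 5.5 via
  Lemmas 5.3–5.4): a vector of `H₊ + H₋` with equal components lies in `i₋(H₋)`;
* the transfer theorem `mem_Hminus_iff_of_unramified` (`MeyerRatLogCoordinate`),

we obtain:

* `mem_Hminus_of_iMinus_mem_Hplus` — **diagonal vectors of `H₊` lie in `H₋`** (any `K`), so that
  `{h | (h, h) ∈ H₊} = H₊ ∩ H₋` read inside `H₋`;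
* `exists_isAddHaarMeasure_measure_adeleFundamentalDomain_eq_one` — the self-dual normalisation
  exists (any `K`);
* **`meyerSum_ratTensor_mem_Hminus`** — `h_G = Σ(G ⊗ 1_Ẑ) ∈ H₋` (`K = ℚ`), i.e. `h_G ∈ H₊ ∩ H₋`:
  the explicit supply of vectors of `H₊ ∩ H₋` for the lower bound `mult(|x|^s, π₋) ≥ ord_s Λ`;
* **`contDiff_and_bounds_theta_logCoordinate`** — the classical consequence on the real line: for
  `G ∈ 𝓢(ℝ)` with `G(0) = 0 = ∫ G` and every `α ∈ ℝ`, the function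
  `y ↦ e^{αy} ∑_{n ≠ 0} G(n e^y)` is smooth and `sup_y (1+|y|)^β ‖∂ⁿ(…)‖ < ∞` for all `n, β` — the
  theta series `∑_{n≠0} G(nt)` decays faster than any power of `t` at `0` AND `∞` with all
  `t∂_t`-derivatives (usually proved from `θ_G(1/t) = t θ_{Ĝ}(t)`; here it drops out of the adelic
  theory) [Meyer2005, §5.7: "the Fourier–Laplace transform of `h` is holomorphic on all of `Ĉ_K`…"].

Everything is proved; no definitions, no named facts.

## References

* R. Meyer, *On a representation of the idele class group related to primes and zeros of
  L-functions*, Duke Math. J. 127 (2005) = arXiv:math/0311468, Lemma 5.5, §5.7 [Meyer2005].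
-/

noncomputable section

open MeasureTheory MeasureTheory.Measure NumberField IsDedekindDomain
open scoped NNReal ENNReal ContDiff

namespace Literature.NumberTheory.Automorphic.Meyer

/-! ### Diagonal vectors of `H₊` lie in `H₋` -/

section General

variable {K : Type} [Field K] [NumberField K]

/-- `i₋ f = (f, f)` is injective. [folklore] -/
theorem iMinus_injective : Function.Injective (iMinus K) := fun f g h => by
  have h1 := congrArg Prod.fst h
  rwa [iMinus_apply, iMinus_apply] at h1

variable [MeasurableSpace (AdeleRing (𝓞 K) K)] [BorelSpace (AdeleRing (𝓞 K) K)]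
  (μ : Measure (AdeleRing (𝓞 K) K)) [μ.IsAddHaarMeasure]

/-- **Diagonal vectors of `H₊` lie in `H₋`**: if `(h, h) ∈ H₊` then `h ∈ H₋` (so `(h, h) ∈ H₊ ∩ H₋`);
from `H₊ ⊆ 𝒮_{(1,∞)} ⊕ 𝒮_{(-∞,0)}` and `𝒮_{(1,∞)} ∩ 𝒮_{(-∞,0)} ⊆ H₋` [Meyer2005, Lemma 5.5].
[cite: Meyer2005, Lemma 5.5] -/
theorem mem_Hminus_of_iMinus_mem_Hplus {h : IdeleClassGroup K → ℂ} (hh : iMinus K h ∈ Hplus K μ) :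
    h ∈ Hminus K := by
  have hsum : iMinus K h ∈ Hsum K μ := Submodule.mem_sup_left hh
  have h0 : (iMinus K h).1 - (iMinus K h).2 = 0 := by
    rw [iMinus_apply]
    exact sub_self _
  obtain ⟨f, hf, hfh⟩ := Submodule.mem_map.mp (mem_HminusIm_of_fst_sub_snd_eq_zero μ hsum h0)
  rw [← iMinus_injective hfh]
  exact hf

omit [MeasurableSpace (AdeleRing (𝓞 K) K)] [BorelSpace (AdeleRing (𝓞 K) K)] μ in
/-- **The self-dual normalisation exists**: some additive Haar measure on `𝔸_K` gives Tate's
fundamental domain measure `1` (`0 < μ₀(D) < ∞` for any Haar `μ₀`; rescale). [cite: Meyer2005, §5.1] -/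
theorem exists_isAddHaarMeasure_measure_adeleFundamentalDomain_eq_one (K : Type) [Field K] [NumberField K]
    [MeasurableSpace (AdeleRing (𝓞 K) K)] [BorelSpace (AdeleRing (𝓞 K) K)] :
    ∃ μ : Measure (AdeleRing (𝓞 K) K), μ.IsAddHaarMeasure ∧ μ (adeleFundamentalDomain K) = 1 := by
  haveI := locallyCompactSpace_adeleRing' K
  haveI := secondCountableTopology_adeleRing K
  set μ₀ : Measure (AdeleRing (𝓞 K) K) := Measure.addHaar with hμ₀
  have hpos := measure_adeleFundamentalDomain_pos K μ₀
  have hlt := measure_adeleFundamentalDomain_lt_top K μ₀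
  refine ⟨(μ₀ (adeleFundamentalDomain K))⁻¹ • μ₀, ?_, ?_⟩
  · exact IsAddHaarMeasure.smul μ₀ (ENNReal.inv_ne_zero.mpr hlt.ne) (ENNReal.inv_ne_top.mpr hpos.ne')
  · rw [Measure.smul_apply, smul_eq_mul, ENNReal.inv_mul_cancel hpos.ne' hlt.ne]

end General

/-! ### `K = ℚ`: `h_G = Σ(G ⊗ 1_Ẑ) ∈ H₋` and its consequence on the real line -/

section Rat

variable [MeasurableSpace (AdeleRing (𝓞 ℚ) ℚ)] [BorelSpace (AdeleRing (𝓞 ℚ) ℚ)]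
  (μ : Measure (AdeleRing (𝓞 ℚ) ℚ)) [μ.IsAddHaarMeasure]

/-- **`h_G = Σ(G ⊗ 1_Ẑ) ∈ H₋`** for `G ∈ 𝓢(ℝ)` with `G(0) = 0 = ∫ G` (and the self-dual `μ` in the
definition of `H₊`): the theta vectors lie in `H₊ ∩ H₋`. [cite: Meyer2005, Lemma 5.5] -/
theorem meyerSum_ratTensor_mem_Hminus (hμ : μ (adeleFundamentalDomain ℚ) = 1) (G : SchwartzMap ℝ ℂ)
    (h0 : G 0 = 0) (hG : ∫ t : ℝ, G t = 0) : meyerSum ℚ (ratTensor G) ∈ Hminus ℚ :=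
  mem_Hminus_of_iMinus_mem_Hplus μ (iMinus_meyerSum_ratTensor_mem_Hplus μ hμ G h0 hG)

omit [MeasurableSpace (AdeleRing (𝓞 ℚ) ℚ)] [BorelSpace (AdeleRing (𝓞 ℚ) ℚ)] μ in
/-- **Theta series in the logarithmic coordinate are super-Schwartz**: for `G ∈ 𝓢(ℝ)` with
`G(0) = 0 = ∫ G` and every `α ∈ ℝ`, `y ↦ e^{αy} ∑_{n ∈ ℤ, n ≠ 0} G(n e^y)` is smooth with
`sup_y (1+|y|)^β ‖∂ⁿ_y (e^{αy} ∑_{n≠0} G(n e^y))‖ < ∞` for all `n, β ∈ ℕ`.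
[cite: Meyer2005, §5.7] -/
theorem contDiff_and_bounds_theta_logCoordinate (G : SchwartzMap ℝ ℂ) (h0 : G 0 = 0)
    (hG : ∫ t : ℝ, G t = 0) (α : ℝ) :
    ContDiff ℝ ∞ (fun y : ℝ => (∑' n : ℤ, if n = 0 then (0 : ℂ) else G (n * Real.exp y)) * (Real.exp (α * y) : ℂ)) ∧
      ∀ n β : ℕ, ∃ C : ℝ, ∀ y : ℝ,
        (1 + |y|) ^ β * ‖iteratedFDeriv ℝ n
          (fun y : ℝ => (∑' n : ℤ, if n = 0 then (0 : ℂ) else G (n * Real.exp y)) * (Real.exp (α * y) : ℂ)) y‖ ≤ C := by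
  letI : MeasurableSpace (AdeleRing (𝓞 ℚ) ℚ) := borel _
  haveI : BorelSpace (AdeleRing (𝓞 ℚ) ℚ) := ⟨rfl⟩
  obtain ⟨μ, hμH, hμ⟩ := exists_isAddHaarMeasure_measure_adeleFundamentalDomain_eq_one ℚ
  haveI := hμH
  have hunr : ∀ u ∈ integralFiniteUnits ℚ, ∀ x,
      meyerSum ℚ (ratTensor G) (x * finiteUnitClass ℚ u) = meyerSum ℚ (ratTensor G) x :=
    fun u hu x => meyerSum_ratTensor_mul_finiteUnitClass (G : ℝ → ℂ) hu x
  have h := (mem_Hminus_iff_of_unramified hunr).mp (meyerSum_ratTensor_mem_Hminus μ hμ G h0 hG) α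
  simp only [meyerSum_ratTensor_eq, classNorm_posClass] at h
  exact h

end Rat

end Literature.NumberTheory.Automorphic.Meyer
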